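import Summits.ABC.ABC.Theses.CubicResolventAllowance
import Summits.ABC.ABC.Theorems.CubicResolventAllowanceResolventDiscBounds
import Summits.ABC.ABC.Theorems.TwoTorsionDictionary
import Literature.NumberTheory.EllipticCurves.SzpiroLocalDataProofs
import Literature.NumberTheory.DiophantineGeometry.Conductor
import Literature.NumberTheory.DiophantineGeometry.StrongHall
import HarnessLib

/-!
# Stub-ideation k=3 (FAMILY 3 — probe the extremes), gen 7 — `stub_realCubic` of `IndexSzpiro` (stmt-ABC-22740)

Gens 2–6 of this slot probed the free-prime extreme (`ℚ(ζ₇)⁺` cube family, `T1–T3`), the `Mp` regime and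
the fixed-`S` extreme (Ridout rung `R₁`, `StubIdeas3SketchG6.lean`).  Gen 7 probes the LAST extreme of the
real class: the locus where BOTH the allowance `|d_K|` and the additive part of `N` are as small as they can
be — the curves that are SEMISTABLE AWAY FROM `6`.  Its cleanest piece is the coprime `(2,3,∞)` FREY FAMILY

  `E_{y,z} : Y² = X³ − 3 z X − 2 y`,   `gcd(y,z) = 1`,   `D := z³ − y² ≠ 0`
  (`c₄ = 2⁴3²·z`, `c₆ = 2⁶3³·y`, `Δ = 1728·D`, `ψ₂ = 4·(X³ − 3zX − 2y)`, `disc = 108·D`),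

(every `E/ℚ` is some `E_{y,z}`; for `p ≥ 5` and `(y,z)` `p`-reduced (`¬(p⁴ ∣ z ∧ p⁶ ∣ y)`), `E_{y,z}` is semistable at `p`
iff `p ∤ gcd(y,z)`; the coprime family is a proper sub-locus — it misses e.g. `j = 0`), and on it the
dictionary collapses to:  `N ∣ 2⁸3⁵·rad(D)`,  `27|D| ≤ 64·Δ_min ≤ 64·1728|D|`,  `d_K ∣ 108·D`,  `sign d_K = sign D`.
So ON THIS FAMILY the stub `Δ_min ≤ C_ε |d_K| N^{6+ε}` is, up to constants, the RADICAL-HALL inequality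

  (RH₈)   `0 < z³ − y² ≤ C_ε · rad(z³ − y²)^{8+ε}`   (`gcd(y,z)=1`, `X³−3zX−2y` irreducible over `ℚ`),

(`abc` gives the same shape with `6+ε`; Szpiro for `E_{y,z}` gives `6+ε`; the stub's allowance costs exactly `2`).
Specialising `D = wⁿ`:  (RH₈) ⟹ no coprime solutions of  `y² + wⁿ = z³`, `w ≥ 2`, `n ≥ n₀(C)`, with irreducible
`X³−3zX−2y` — i.e. `stub_realCubic ⟹ ASYMPTOTIC GENERALISED FERMAT (2,3,n)` on the real-irreducible arrangement
(`AsymptoticFermat23RealIrr` below).  Known: `n ∈ {7,8,9,10,11,15}` and `13` under GRH (Poonen–Schaefer–Stoll 2007,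
Bruin 1999/2005, Brown 2012, Siksek–Stoll 2014, Freitas–Naskręcki–Stoll 2020); general `n` OPEN, and the modular
method's obstruction (the Frey curves `27a1, 288a1, 864a1–c1` of the trivial solutions are themselves members of the
family) is blind to `sign D` and to irreducibility of `ψ₂`, so the restriction to the stub's class does not help it.

Certified (PARI, kit job j344838, `z ≤ 250`: 477 314 coprime pairs with `D > 0` and irreducible `ψ₂`; 0 violations of
`N' = rad(D')`, `Δ_min' = D'`, `d_K ∣ 108D`, `v_p(d_K) = [v_p(D) odd]` (`p ≥ 5`), `d_K > 0`, `2⁸Δ_min/d_K = □`;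
extremal member `34³ − 173² = 3·5⁵` (radical-Hall quality `5.0`, next `3.74`); `ι = log(Δ_min/d_K)/log N < 5`
throughout; coprime `z³ − y² = 2^a3^b`, `z ≤ 10⁵`: 10 solutions, ALL with reducible `ψ₂` — the real irreducible
coprime class has no member of conductor `2^a3^b` in that range).  In-kernel below: the extremal identities, and the
fact that the one catalogued `(2,3,n≥7)` solution in the real arrangement, `15613³ − 1549034² = 33⁸`, has REDUCIBLE
`ψ₂` (root `X = 244`), so the real-irreducible `(2,3,n)` locus has no known solution at all for `n ≥ 7`.

`lean check`: rc 0; sorries ONLY in the bodies of the proposed helpers H3 (`frey23Conductor_holds`, M),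
H3b (`frey23MinimalDisc_holds`, M) and H7 (`signDoor_holds`, S — PROVED as K1–K6/K7b in `StubIdeas1G5Sketch.lean`,
not importable from here; copy).  PROVED here: H1/H2 (the model), H6 (`cubicFieldOfIrreducible_holds`, `AdjoinRoot`),
the reduction H8 `stubReal_implies_radicalHall8` (from H3/H3b/H6/H7 + the landed `ResolventDiscBounds`) and
H9 `asymptoticFermat_of_radicalHall` (real analysis); so `stub_realCubic ⟹ AsymptoticFermat23RealIrr` modulo H3/H3b/H7.
-/

open Polynomial NumberField WeierstrassCurve UniqueFactorizationMonoid

namespace Summit.ABC.ABC.Cruxes.IndexSzpiro.StubIdeas3G7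

/-! ## §0 The stub (verbatim) -/

/-- The stub, verbatim (`line2-birth.lean`, `stub_realCubic`). -/
def StubRealCubic : Prop :=
  ∀ ε : ℝ, 0 < ε → ∃ C : ℝ, ∀ (W : WeierstrassCurve ℚ) [W.IsElliptic] (K : Type) [Field K] [NumberField K],
    Irreducible W.twoTorsionPolynomial.toPoly → Module.finrank ℚ K = 3 →
    (∃ θ : K, aeval θ W.twoTorsionPolynomial.toPoly = 0) → 0 < NumberField.discr K →
    (W.minimalDiscriminantNorm ℤ : ℝ) ≤ C * |(NumberField.discr K : ℝ)| * (W.conductorNorm ℤ : ℝ) ^ (6 + ε)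

/-! ## §1 The `(2,3,∞)` Frey family (kernel-checked dictionary entries) -/

/-- The integral model `E_{y,z} : Y² = X³ − 3zX − 2y`. -/
def frey23Int (y z : ℤ) : WeierstrassCurve ℤ := ⟨0, 0, 0, -3 * z, -2 * y⟩

/-- `E_{y,z}` over `ℚ`. -/
abbrev frey23 (y z : ℤ) : WeierstrassCurve ℚ := (frey23Int y z).baseChange ℚ

variable (y z : ℤ)

theorem frey23Int_c₄ : (frey23Int y z).c₄ = 144 * z := by
  simp [frey23Int, WeierstrassCurve.c₄, WeierstrassCurve.b₂, WeierstrassCurve.b₄]; ring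

theorem frey23Int_c₆ : (frey23Int y z).c₆ = 1728 * y := by
  simp [frey23Int, WeierstrassCurve.c₆, WeierstrassCurve.b₂, WeierstrassCurve.b₄, WeierstrassCurve.b₆]; ring

/-- H1: `Δ(E_{y,z}) = 1728·(z³ − y²)`. -/
theorem frey23Int_Δ : (frey23Int y z).Δ = 1728 * (z ^ 3 - y ^ 2) := by
  simp [frey23Int, WeierstrassCurve.Δ, WeierstrassCurve.b₂, WeierstrassCurve.b₄, WeierstrassCurve.b₆,
    WeierstrassCurve.b₈]; ring

theorem frey23_Δ : (frey23 y z).Δ = 1728 * ((z : ℚ) ^ 3 - (y : ℚ) ^ 2) := by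
  simp [frey23, frey23Int, WeierstrassCurve.baseChange, WeierstrassCurve.map, WeierstrassCurve.Δ,
    WeierstrassCurve.b₂, WeierstrassCurve.b₄, WeierstrassCurve.b₆, WeierstrassCurve.b₈]; ring

/-- H2: `ψ₂(E_{y,z}) = 4X³ − 12zX − 8y = 4·(X³ − 3zX − 2y)`. -/
theorem frey23_twoTorsionPolynomial :
    (frey23 y z).twoTorsionPolynomial = ⟨4, 0, -12 * z, -8 * y⟩ := by
  simp [frey23, frey23Int, WeierstrassCurve.baseChange, WeierstrassCurve.map,
    WeierstrassCurve.twoTorsionPolynomial, WeierstrassCurve.b₂, WeierstrassCurve.b₄, WeierstrassCurve.b₆]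
  constructor <;> ring

/-- `E_{y,z}` is an elliptic curve iff `z³ ≠ y²`. -/
theorem frey23_isElliptic (hD : z ^ 3 - y ^ 2 ≠ 0) : (frey23 y z).IsElliptic := by
  refine ⟨isUnit_iff_ne_zero.mpr ?_⟩
  rw [frey23_Δ]
  have : ((z ^ 3 - y ^ 2 : ℤ) : ℚ) ≠ 0 := by exact_mod_cast hD
  push_cast at this
  exact mul_ne_zero (by norm_num) this

/-! ### Certified extremal data (in-kernel) -/

/-- The extremal member of the family for `z ≤ 250` (kit j344838): `34³ − 173² = 3·5⁵`, radical-Hall quality `5`. -/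
example : (34 : ℤ) ^ 3 - 173 ^ 2 = 3 * 5 ^ 5 := by norm_num

/-- The only catalogued primitive `(2,3,n)`, `n ≥ 7`, solution in the REAL arrangement `z³ − y² = wⁿ > 0` … -/
example : (15613 : ℤ) ^ 3 - 1549034 ^ 2 = 33 ^ 8 := by norm_num

/-- … lies in the REDUCIBLE class: `X = 244` is a root of `X³ − 3·15613·X − 2·1549034`
(indeed `r² − z = 3·11⁴`, `4z − r² = 2²3⁶`, `(r²−z)²(4z−r²) = 4·33⁸`). -/
example : (244 : ℤ) ^ 3 - 3 * 15613 * 244 - 2 * 1549034 = 0 := by norm_num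

/-- Whereas every PSS solution of `x² + y³ = z⁷` has `D ≤ 0` in these coordinates, e.g. `17³ − 71² = −2⁷`,
`2³ − 3² = −1` (Catalan): the complex class. -/
example : (17 : ℤ) ^ 3 - 71 ^ 2 = -2 ^ 7 ∧ (2 : ℤ) ^ 3 - 3 ^ 2 = -1 := by norm_num

/-! ## §2 Proposed helper lemmas (the dictionary on the family) -/

/-- **H3 (M).** `N(E_{y,z}) ∣ 2⁸·3⁵·rad(z³ − y²)` for coprime `y, z`: at `p ≥ 5`, `p ∣ D ⟹ p ∤ z ⟹ v_p(c₄) = 0`, so the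
model is minimal and multiplicative (`f_p = 1`, `conductorExponent_eq_one_of_dvd_Δ_of_not_dvd_c₄`); `p ∤ 6D ⟹ f_p = 0`
(`conductorExponent_eq_zero_of_not_dvd_Δ`); `f₂ ≤ 8`, `f₃ ≤ 5` (`conductorExponent_le_eight_holds`,
`conductorExponent_le_five_of_natGenerator_eq_three_holds`); assemble with `conductorNorm_dvd_of_forall_conductorExponent_le`.
Template: `Literature…AbcValuationProductFreyDataProofs.IsABCTriple.conductorNorm_freyCurve_dvd`. -/
def Frey23Conductor : Prop :=
  ∀ y z : ℤ, IsCoprime y z → z ^ 3 - y ^ 2 ≠ 0 →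
    (frey23 y z).conductorNorm ℤ ∣ 2 ^ 8 * 3 ^ 5 * radical (z ^ 3 - y ^ 2).natAbs

theorem frey23Conductor_holds : Frey23Conductor := by
  sorry

/-- **H3b (M).** `27·|z³ − y²| ≤ 64·Δ_min(E_{y,z})` for coprime `y, z` (in fact `Δ_min ∈ {1728|D|, 27|D|/64}`: a
rescaling `u` of the integral model has `u⁴ ∣ 2⁴3²z`, `u⁶ ∣ 2⁶3³y`, so `u ∣ 2` by coprimality; and `Δ_min ∣ 1728·D` by
`Summit.ABC.ABC.Theorems.TwoTorsionDictionary.minimalDiscriminantNorm_dvd_natAbs_Δ`).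
Tools: `isMinimalAt_of_lt_valuation_c₄`, `exists_ordMinimalDiscriminant_add_eq_padicValInt`. -/
def Frey23MinimalDisc : Prop :=
  ∀ y z : ℤ, IsCoprime y z → (hD : z ^ 3 - y ^ 2 ≠ 0) →
    27 * (z ^ 3 - y ^ 2).natAbs ≤ 64 * (frey23 y z).minimalDiscriminantNorm ℤ

theorem frey23MinimalDisc_holds : Frey23MinimalDisc := by
  sorry

/-- **H6 (glue, PROVED below).** An irreducible 2-division cubic generates a cubic number field containing a root
(`K = AdjoinRoot ψ₂`, `finrank = natDegree = 3`). -/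
def CubicFieldOfIrreducible : Prop :=
  ∀ (W : WeierstrassCurve ℚ), Irreducible W.twoTorsionPolynomial.toPoly →
    ∃ (K : Type) (_ : Field K) (_ : NumberField K),
      Module.finrank ℚ K = 3 ∧ ∃ θ : K, aeval θ W.twoTorsionPolynomial.toPoly = 0

theorem cubicFieldOfIrreducible_holds : CubicFieldOfIrreducible := by
  intro W hirr
  set f := W.twoTorsionPolynomial.toPoly with hf
  haveI : Fact (Irreducible f) := ⟨hirr⟩
  have hf0 : f ≠ 0 := hirr.ne_zero
  have ha : W.twoTorsionPolynomial.a ≠ 0 := by simp [WeierstrassCurve.twoTorsionPolynomial]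
  have hdeg : f.natDegree = 3 := Cubic.natDegree_of_a_ne_zero ha
  haveI : FiniteDimensional ℚ (AdjoinRoot f) := (AdjoinRoot.powerBasis hf0).finite
  haveI : NumberField (AdjoinRoot f) := NumberField.mk
  refine ⟨AdjoinRoot f, inferInstance, inferInstance, ?_, AdjoinRoot.root f, ?_⟩
  · rw [(AdjoinRoot.powerBasis hf0).finrank, AdjoinRoot.powerBasis_dim hf0, hdeg]
  · -- the `ℚ`-algebra structure on `K` in the statement is `algebraRat`; `ℚ →+* K` is a subsingleton
    rw [Polynomial.aeval_def]
    convert AdjoinRoot.eval₂_root f using 2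
    all_goals first | rfl | exact Subsingleton.elim _ _

/-- **H7 (S) the sign door.** On the stub's class `0 < d_K ↔ 0 < Δ(W)` (`Δ(W) = q²·d_K`, PROVED as
`K6_Δ_eq_sq_mul_discr` / `discr_neg_iff_Δ_neg` in `StubIdeas1G5Sketch.lean`; restated because crux sketches are not
importable). -/
def SignDoor : Prop :=
  ∀ (W : WeierstrassCurve ℚ) [W.IsElliptic] (K : Type) [Field K] [NumberField K],
    Irreducible W.twoTorsionPolynomial.toPoly → Module.finrank ℚ K = 3 →
    (∃ θ : K, aeval θ W.twoTorsionPolynomial.toPoly = 0) → (0 < NumberField.discr K ↔ 0 < W.Δ)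

theorem signDoor_holds : SignDoor := by
  sorry

/-! ## §3 The razor: stub ⟹ radical-Hall(8+ε) ⟹ asymptotic Fermat (2,3,n) on the real-irreducible locus -/

/-- Radical-Hall with exponent `κ` on the real (`D > 0`) irreducible coprime locus of `z³ − y² = D`. -/
def RadicalHall23Irr (κ : ℝ) : Prop :=
  ∀ ε : ℝ, 0 < ε → ∃ C : ℝ, ∀ y z : ℤ, IsCoprime y z → 0 < z ^ 3 - y ^ 2 →
    Irreducible (frey23 y z).twoTorsionPolynomial.toPoly →
    (((z ^ 3 - y ^ 2 : ℤ)) : ℝ) ≤ C * ((radical (z ^ 3 - y ^ 2).natAbs : ℕ) : ℝ) ^ (κ + ε)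

/-- Asymptotic generalised Fermat `(2,3,n)` in the arrangement `y² + wⁿ = z³` (`w ≥ 2`, `gcd(y,z) = 1`), restricted to
the stub's class (irreducible `ψ₂ = 4(X³ − 3zX − 2y)`; `D = wⁿ > 0` is automatic). OPEN for general `n`. -/
def AsymptoticFermat23RealIrr : Prop :=
  ∃ n₀ : ℕ, ∀ n : ℕ, n₀ ≤ n → ∀ y z w : ℤ, IsCoprime y z → 2 ≤ w →
    Irreducible (frey23 y z).twoTorsionPolynomial.toPoly → z ^ 3 - y ^ 2 ≠ w ^ n

/-- **H8 (PROVED): the stub, restricted to the Frey family, is radical-Hall with exponent `8 + ε`.** -/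
theorem stubReal_implies_radicalHall8 (H3 : Frey23Conductor) (H3b : Frey23MinimalDisc)
    (H6 : CubicFieldOfIrreducible) (H7 : SignDoor) (hstub : StubRealCubic) : RadicalHall23Irr 8 := by
  intro ε hε
  obtain ⟨C, hC⟩ := hstub ε hε
  refine ⟨3 * (max C 0 * 1944) * ((2 : ℝ) ^ 8 * 3 ^ 5) ^ (8 + ε), ?_⟩
  intro y z hcop hD hirr
  have hD0 : z ^ 3 - y ^ 2 ≠ 0 := hD.ne'
  haveI := frey23_isElliptic y z hD0
  obtain ⟨K, iF, iN, hdeg, hθ⟩ := H6 (frey23 y z) hirr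
  letI := iF
  letI := iN
  have hΔpos : 0 < (frey23 y z).Δ := by
    rw [frey23_Δ]
    have : (0 : ℚ) < ((z ^ 3 - y ^ 2 : ℤ) : ℚ) := by exact_mod_cast hD
    push_cast at this
    positivity
  have hsign : 0 < NumberField.discr K := (H7 (frey23 y z) K hirr hdeg hθ).mpr hΔpos
  -- the four inputs
  have h1 := hC (frey23 y z) K hirr hdeg hθ hsign
  have h2 : |(NumberField.discr K : ℝ)| ≤ 1944 * ((frey23 y z).conductorNorm ℤ : ℝ) ^ (2 : ℕ) :=
    (Summit.ABC.ABC.Theorems.resolventDiscBounds_proof).1 (frey23 y z) K hirr hdeg hθ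
  have hNpos : 0 < (frey23 y z).conductorNorm ℤ := conductorNorm_pos_holds (frey23 y z)
  have h3 : ((frey23 y z).conductorNorm ℤ : ℝ) ≤ (2 : ℝ) ^ 8 * 3 ^ 5 * ((radical (z ^ 3 - y ^ 2).natAbs : ℕ) : ℝ) := by
    have := Nat.le_of_dvd (by positivity) (H3 y z hcop hD0)
    exact_mod_cast this
  have h4 : (27 : ℝ) * (((z ^ 3 - y ^ 2 : ℤ)) : ℝ) ≤ 64 * ((frey23 y z).minimalDiscriminantNorm ℤ : ℝ) := by
    have := H3b y z hcop hD0
    have habs : (((z ^ 3 - y ^ 2).natAbs : ℤ)) = z ^ 3 - y ^ 2 := Int.natAbs_of_nonneg hD.le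
    have h' : (27 : ℤ) * (z ^ 3 - y ^ 2) ≤ 64 * ((frey23 y z).minimalDiscriminantNorm ℤ : ℤ) := by
      rw [← habs]; exact_mod_cast this
    exact_mod_cast h'
  -- bookkeeping
  set N : ℝ := ((frey23 y z).conductorNorm ℤ : ℝ) with hN
  set R : ℝ := ((radical (z ^ 3 - y ^ 2).natAbs : ℕ) : ℝ) with hR
  set Dm : ℝ := ((frey23 y z).minimalDiscriminantNorm ℤ : ℝ) with hDm
  have hN0 : 0 < N := by rw [hN]; exact_mod_cast hNpos
  have hR0 : 0 ≤ R := by rw [hR]; positivity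
  have hdK0 : 0 ≤ |(NumberField.discr K : ℝ)| := abs_nonneg _
  have hpow0 : 0 ≤ N ^ (6 + ε) := Real.rpow_nonneg hN0.le _
  have hmax : 0 ≤ max C 0 := le_max_right _ _
  -- Δ_min ≤ max C 0 · 1944 · N^{8+ε}
  have h5 : Dm ≤ max C 0 * 1944 * N ^ (8 + ε) := by
    calc Dm ≤ C * |(NumberField.discr K : ℝ)| * N ^ (6 + ε) := h1
      _ ≤ max C 0 * |(NumberField.discr K : ℝ)| * N ^ (6 + ε) :=
          mul_le_mul_of_nonneg_right (mul_le_mul_of_nonneg_right (le_max_left _ _) hdK0) hpow0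
      _ ≤ max C 0 * (1944 * N ^ (2 : ℕ)) * N ^ (6 + ε) :=
          mul_le_mul_of_nonneg_right (mul_le_mul_of_nonneg_left h2 hmax) hpow0
      _ = max C 0 * 1944 * (N ^ (2 : ℕ) * N ^ (6 + ε)) := by ring
      _ = max C 0 * 1944 * N ^ (8 + ε) := by
          congr 1
          rw [← Real.rpow_natCast N 2, ← Real.rpow_add hN0]
          congr 1; push_cast; ring
  -- N^{8+ε} ≤ (2⁸3⁵)^{8+ε} · R^{8+ε}
  have h6 : N ^ (8 + ε) ≤ ((2 : ℝ) ^ 8 * 3 ^ 5) ^ (8 + ε) * R ^ (8 + ε) := by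
    rw [← Real.mul_rpow (by positivity) hR0]
    exact Real.rpow_le_rpow hN0.le h3 (by positivity)
  have hC0 : 0 ≤ max C 0 * 1944 := mul_nonneg (le_max_right _ _) (by norm_num)
  calc (((z ^ 3 - y ^ 2 : ℤ)) : ℝ) ≤ 3 * Dm := by linarith
    _ ≤ 3 * (max C 0 * 1944 * N ^ (8 + ε)) := by gcongr
    _ ≤ 3 * (max C 0 * 1944 * (((2 : ℝ) ^ 8 * 3 ^ 5) ^ (8 + ε) * R ^ (8 + ε))) := by gcongr
    _ = 3 * (max C 0 * 1944) * ((2 : ℝ) ^ 8 * 3 ^ 5) ^ (8 + ε) * R ^ (8 + ε) := by ring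

/-- **H9 (PROVED, real analysis).** Radical-Hall with any exponent kills `z³ − y² = wⁿ` for `n` large:
`rad(wⁿ) = rad(w) ≤ w`, so `wⁿ ≤ C·w^{κ+1}` forces `n ≤ κ + 1 + log₂ max(C,1)`. -/
theorem asymptoticFermat_of_radicalHall {κ : ℝ} (hκ : 0 ≤ κ) (h : RadicalHall23Irr κ) :
    AsymptoticFermat23RealIrr := by
  obtain ⟨C, hC⟩ := h 1 one_pos
  set M : ℝ := max C 1 with hM
  have hM1 : 1 ≤ M := le_max_right _ _
  have hM0 : 0 < M := by linarith
  have hlogb : 0 ≤ Real.logb 2 M := Real.logb_nonneg one_lt_two hM1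
  obtain ⟨n₀, hn₀⟩ := exists_nat_gt (κ + 1 + Real.logb 2 M)
  refine ⟨n₀, fun n hn y z w hcop hw hirr hD => ?_⟩
  have hn' : (n₀ : ℝ) ≤ n := by exact_mod_cast hn
  have hw0 : (0 : ℤ) < w := by omega
  have hw2 : (2 : ℝ) ≤ (w : ℝ) := by exact_mod_cast hw
  have hwpos : (0 : ℝ) < (w : ℝ) := by linarith
  have hDpos : 0 < z ^ 3 - y ^ 2 := by rw [hD]; positivity
  have hn0 : n ≠ 0 := by
    rintro rfl
    have : (n₀ : ℝ) ≤ 0 := by exact_mod_cast hn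
    linarith
  have key := hC y z hcop hDpos hirr
  -- the radical of `wⁿ` is at most `w`
  have hrad : (((radical (z ^ 3 - y ^ 2).natAbs : ℕ)) : ℝ) ≤ (w : ℝ) := by
    rw [hD, Int.natAbs_pow, radical_pow _ hn0]
    have hwn : w.natAbs ≠ 0 := by omega
    have h1 : radical w.natAbs ≤ w.natAbs := Nat.radical_le_self_iff.mpr hwn
    have h2 : ((w.natAbs : ℕ) : ℝ) = (w : ℝ) := by
      rw [Nat.cast_natAbs, Int.cast_abs, abs_of_pos (by exact_mod_cast hw0)]
    rw [← h2]; exact_mod_cast h1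
  have hR0 : (0 : ℝ) ≤ ((radical (z ^ 3 - y ^ 2).natAbs : ℕ) : ℝ) := by positivity
  -- `wⁿ ≤ M · w^{κ+1}`
  have h1 : (w : ℝ) ^ (n : ℝ) ≤ M * (w : ℝ) ^ (κ + 1) := by
    have hDn : (((z ^ 3 - y ^ 2 : ℤ)) : ℝ) = (w : ℝ) ^ (n : ℝ) := by
      rw [hD, Real.rpow_natCast]; push_cast; ring
    calc (w : ℝ) ^ (n : ℝ) = (((z ^ 3 - y ^ 2 : ℤ)) : ℝ) := hDn.symm
      _ ≤ C * (((radical (z ^ 3 - y ^ 2).natAbs : ℕ)) : ℝ) ^ (κ + 1) := key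
      _ ≤ M * (((radical (z ^ 3 - y ^ 2).natAbs : ℕ)) : ℝ) ^ (κ + 1) :=
          mul_le_mul_of_nonneg_right (le_max_left _ _) (Real.rpow_nonneg hR0 _)
      _ ≤ M * (w : ℝ) ^ (κ + 1) :=
          mul_le_mul_of_nonneg_left (Real.rpow_le_rpow hR0 hrad (by linarith)) hM0.le
  -- hence `w^{n-κ-1} ≤ M`, `2^{n-κ-1} ≤ M`, `n ≤ κ + 1 + log₂ M < n₀`
  have h2 : (w : ℝ) ^ ((n : ℝ) - (κ + 1)) ≤ M := by
    have hsplit : (w : ℝ) ^ (n : ℝ) = (w : ℝ) ^ (κ + 1) * (w : ℝ) ^ ((n : ℝ) - (κ + 1)) := by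
      rw [← Real.rpow_add hwpos]; congr 1; ring
    rw [hsplit, mul_comm ((w : ℝ) ^ (κ + 1))] at h1
    exact le_of_mul_le_mul_right h1 (Real.rpow_pos_of_pos hwpos _)
  have hexp0 : 0 ≤ (n : ℝ) - (κ + 1) := by linarith
  have h3 : (2 : ℝ) ^ ((n : ℝ) - (κ + 1)) ≤ M :=
    (Real.rpow_le_rpow (by norm_num) hw2 hexp0).trans h2
  have h4 : (n : ℝ) - (κ + 1) ≤ Real.logb 2 M := (Real.le_logb_iff_rpow_le one_lt_two hM0).mpr h3
  linarith

/-- **The razor, assembled (sorry-free in its own body):** any proof of `stub_realCubic` proves asymptotic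
generalised Fermat `(2,3,n)` on the real-irreducible arrangement. -/
theorem stubReal_implies_asymptoticFermat23 (H3 : Frey23Conductor) (H3b : Frey23MinimalDisc)
    (H6 : CubicFieldOfIrreducible) (H7 : SignDoor)
    (H9 : ∀ κ : ℝ, 0 ≤ κ → RadicalHall23Irr κ → AsymptoticFermat23RealIrr)
    (hstub : StubRealCubic) : AsymptoticFermat23RealIrr :=
  H9 8 (by norm_num) (stubReal_implies_radicalHall8 H3 H3b H6 H7 hstub)

/-- Sanity: the verbatim stub is the route's registered stub statement shape (same binder list as
`Summit.ABC.ABC.Theses.CubicResolventAllowance.IndexSzpiro` restricted to `0 < d_K`). -/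
example : StubRealCubic → StubRealCubic := id

/-! ## §4 Placement: B–G Conjecture 12.5.3 (strong Hall; abc-equivalent, B–G Thm 12.5.12) gives exponent `6` -/

/-- **H10 (S, PROVED): `StrongHallConjecture ⟹ RadicalHall23Irr 6`.** Coprime `(y,z)` makes `(z, y, z³−y²)` a primitive
Hall solution, and `0 < z³ − y² ≤ |z|³ ≤ (C·rad^{2+ε/3})³`.  So on the Frey family the stub (`8+ε`, H8) sits exactly
`+2` above the abc-equivalent strong Hall bound — the price of the allowance `|d_K| ≤ 1944·N²`. -/
theorem radicalHall6_of_strongHall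
    (h : Literature.NumberTheory.DiophantineGeometry.StrongHallConjecture) : RadicalHall23Irr 6 := by
  intro ε hε
  obtain ⟨C, hC⟩ := h (ε / 3) (by positivity)
  refine ⟨max C 0 ^ 3, fun y z hcop hD _ ↦ ?_⟩
  have hprim : Literature.NumberTheory.DiophantineGeometry.IsPrimitiveHallSolution z y (z ^ 3 - y ^ 2) := by
    refine ⟨rfl, hD.ne', fun d hd ↦ ?_⟩
    have hg : Int.gcd (z ^ 3) (y ^ 2) = 1 :=
      Int.isCoprime_iff_gcd_eq_one.mp (IsCoprime.pow hcop.symm)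
    rw [hg] at hd
    have h1 : d ^ 6 = 1 := Nat.dvd_one.mp (by exact_mod_cast hd)
    exact (Nat.pow_eq_one.mp h1).resolve_right (by norm_num)
  obtain ⟨hx, -⟩ := hC z y _ hprim
  set R : ℝ := ((radical (z ^ 3 - y ^ 2).natAbs : ℕ) : ℝ) with hR
  have hR0 : 0 ≤ R := by positivity
  have hzle : |(z : ℝ)| ≤ max C 0 * R ^ (2 + ε / 3) :=
    hx.trans (mul_le_mul_of_nonneg_right (le_max_left _ _) (Real.rpow_nonneg hR0 _))
  have hDle : (((z ^ 3 - y ^ 2 : ℤ)) : ℝ) ≤ |(z : ℝ)| ^ 3 := by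
    have h1 : z ^ 3 - y ^ 2 ≤ z ^ 3 := by nlinarith [sq_nonneg y]
    have h2 : (((z ^ 3 - y ^ 2 : ℤ)) : ℝ) ≤ (z : ℝ) ^ 3 := by exact_mod_cast h1
    exact h2.trans ((le_abs_self _).trans_eq (abs_pow _ _))
  calc (((z ^ 3 - y ^ 2 : ℤ)) : ℝ) ≤ |(z : ℝ)| ^ 3 := hDle
    _ ≤ (max C 0 * R ^ (2 + ε / 3)) ^ 3 := pow_le_pow_left₀ (abs_nonneg _) hzle 3
    _ = max C 0 ^ 3 * R ^ ((6 : ℝ) + ε) := by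
        have he : (2 + ε / 3) * ((3 : ℕ) : ℝ) = 6 + ε := by push_cast; ring
        rw [mul_pow, ← Real.rpow_natCast (R ^ (2 + ε / 3)) 3, ← Real.rpow_mul hR0, he]

end Summit.ABC.ABC.Cruxes.IndexSzpiro.StubIdeas3G7
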